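import Literature.MathematicalPhysics.KineticTheory.LanfordAssembly
import Literature.MathematicalPhysics.KineticTheory.Sweep1EmpiricalProofs
import HarnessLib

/-!
# Hilbert's sixth problem, sweep 1: `lanford_tendstoEmpirical` from the canonical BBGKY-side
# term-by-term analysis (the assembly)

Third companion of `Literature.MathematicalPhysics.KineticTheory.Sweep1` for the named fact
`lanford_tendstoEmpirical` (**hilbert6.S08**, Lanford's theorem in mode B for the canonical
ensemble on `T^d`), after `…Sweep1EmpiricalProofs` (mode A for versions ⇒ mode B, eventual
positivity of the partition functions, and the reduction
`lanford_tendstoEmpirical_of_canonicalChaos` to Lanford's theorem in mode A for the conditioned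
data) and `…Sweep1CanonicalDataProofs` (admissibility of the conditioned data, GST 2013
Prop. 6.1.2). Theorems only; no definition, no named fact; this file does NOT discharge
`lanford_tendstoEmpirical`.

It transposes to the canonical ensemble the assembly `lanford_of_bbgkySide` of
`…LanfordAssembly` (layer L6 of the bottom-up proof of the grand-canonical statement `lanford`,
hilbert6.S02; Cercignani–Illner–Pulvirenti 1994 Thm 4.4.1, proof, Steps 1–4; GST 2013 Thm 8 from
Thms 6–7 and Part III):

* `canonicalChaos_of_bbgkySide` — **Lanford's theorem in mode A for the conditioned data, from
  the canonical BBGKY-side term-by-term analysis.** Hypothesis: for all `β₀, C₀ > 0` (`d ≥ 2`) a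
  horizon `T_B > 0` such that for every Lanford datum `f₀` of mass one, every exact
  Boltzmann–Grad sequence `N_k ε_k^{d-1} = 1` (`ε_k < 1/2`) and all hard-sphere flows `Φ k` on
  `N_k` spheres, there are measurable `s`-particle functions `A_k^{(s),n}(t)`, `t ∈ [0, T_B]`
  (the Duhamel terms of the BBGKY hierarchy of the conditioned data), with uniform majorants
  `M_s rⁿ e^{-β E}` (`0 ≤ r < 1`, `β > 0`; GST Thm 6 / CIP Step 3 with the bounds of Prop. 6.1.2,
  `LanfordEmpirical.eventually_abs_nthMarginal_canonicalDensity_le_pow_mul_exp`), whose sums are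
  versions of the marginals of the good-set-restricted transported conditioned densities
  `(1_{good} · 𝒵_N⁻¹ 1_{D_ε^N} f₀^{⊗N} ∘ Φ^N_{-t})^{(s)}` (the Duhamel representation, CIP 1994
  Thm 4.3.1 iterated), and which converge term by term, in the sense of observables and locally
  uniformly off the diagonal, uniformly on `[0, T_B]`, to the Boltzmann Duhamel terms
  `Q⁰_{s,s+n}(t) f₀^{⊗(s+n)}` (GST Part III with the convergence of the data, Prop. 6.1.2 /
  `LanfordEmpirical.tendstoMarginals_canonicalDensity`). Conclusion: hypothesis `H` of
  `lanford_tendstoEmpirical_of_canonicalChaos`, with `T = min (T₀, T_Σ, T_B)` exactly as in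
  `lanford_of_bbgkySide` (Ukai–Lanford time with the uniform Gaussian bound
  `exists_ukaiLanford_uniform`, summation time of the Boltzmann Duhamel series
  `IsMildBoltzmannSolutionOn.hasSum_boltzmannDuhamelTerm_tensorPow_of_le`, horizon of the input).
  The proof is that of `lanford_of_bbgkySide` with the grand-canonical correlation functions
  replaced by the canonical marginals (the Boltzmann side and the dominated convergence
  `propagatesChaos_of_hasSum` are unchanged).
* `lanford_tendstoEmpirical_of_bbgkySide` — composed with
  `lanford_tendstoEmpirical_of_canonicalChaos`: **the canonical BBGKY-side term-by-term analysis
  implies `lanford_tendstoEmpirical`**. What then remains of hilbert6.S08 is exactly the canonical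
  twin of what remains of hilbert6.S02.

## References

* C. Cercignani, R. Illner, M. Pulvirenti, *The Mathematical Theory of Dilute Gases*, Applied
  Mathematical Sciences 106, Springer (1994), §4.4 Thm 4.4.1, proof, Steps 1–4, pp. 77–86, and
  §4.6 (bib key `CIP1994`).
* I. Gallagher, L. Saint-Raymond, B. Texier, *From Newton to Boltzmann: hard spheres and
  short-range potentials*, EMS ZLAM (2013) = arXiv:1208.5753, §6.1 Prop. 6.1.2, Def. 6.2.1,
  Thms 6–8, Part III (bib key `GST2013`).
* O. E. Lanford, *Time evolution of large classical systems*, LNP 38 (1975) 1–111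
  (bib key `Lanford1975`).
-/

open MeasureTheory Metric Real Set Filter Topology Function
open scoped ENNReal

namespace Literature.MathematicalPhysics.KineticTheory

noncomputable section

open Literature.Analysis.FluidPDE

variable {d : Type*} [Fintype d]

section Assembly

/-- **Lanford's theorem in mode A for the conditioned data on `T^d`, from the canonical
BBGKY-side term-by-term analysis** (CIP 1994 Thm 4.4.1, proof, Steps 1–4; GST 2013 Thm 8 for the
conditioned data of §6.1): see the module docstring for the hypothesis. The conclusion is
hypothesis `H` of `lanford_tendstoEmpirical_of_canonicalChaos` (`Sweep1EmpiricalProofs`), with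
Lanford's time `T = min (T₀, T_Σ, T_B)` depending on `(d, β₀, C₀)` only. Proof: as
`lanford_of_bbgkySide` — the limit is the Ukai–Lanford solution with its uniform Gaussian bound
(`exists_ukaiLanford_uniform`), its tensor powers are the sums of the Boltzmann Duhamel series
(`IsMildBoltzmannSolutionOn.hasSum_boltzmannDuhamelTerm_tensorPow_of_le`), the versions of the
marginals are the sums `∑_n A_k^{(s),n}`, and mode A is dominated convergence of the two series
(`propagatesChaos_of_hasSum`) with merged majorants.
[cite: CIP1994, §4.4 Thm 4.4.1, proof, Steps 1–4, pp. 77–86] -/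
theorem canonicalChaos_of_bbgkySide
    (h : ∀ (_hd : 2 ≤ Fintype.card d) {β₀ C₀ : ℝ}, 0 < β₀ → 0 < C₀ →
      ∃ T_B > (0 : ℝ), ∀ f₀ : UnitAddTorus d → EuclideanSpace ℝ d → ℝ, IsLanfordDatum β₀ C₀ f₀ →
        ∫ x, ∫ v, f₀ x v = 1 →
        ∀ (Nk : ℕ → ℕ) (ε : ℕ → ℝ), IsBoltzmannGradSequenceExact d 1 Nk ε → (∀ k, ε k < 2⁻¹) →
          ∀ Φ : (k : ℕ) → HardSphereFlow (Torus.geometry d) (ε k) (Nk k),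
            ∃ (A : ℕ → (s : ℕ) → ℕ → ℝ → Config s d (UnitAddTorus d) → ℝ) (M : ℕ → ℝ) (r β : ℝ),
              0 ≤ r ∧ r < 1 ∧ 0 < β ∧
              (∀ k s n, ∀ t ∈ Icc 0 T_B, Measurable (A k s n t)) ∧
              (∀ k s n, ∀ t ∈ Icc 0 T_B, ∀ Z,
                |A k s n t Z| ≤ M s * r ^ n * exp (-β * configEnergy Z)) ∧
              (∀ k s, ∀ t ∈ Icc 0 T_B,
                (fun Z => ∑' n, A k s n t Z) =ᵐ[volume]
                  nthMarginal (Nk k) s ((Φ k).good.indicator (hsTransport (Φ k) t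
                    (canonicalDensity (Torus.geometry d) (ε k) (Nk k) (uncurry f₀))))) ∧
              (∀ (s n : ℕ) (φ : (Fin s → EuclideanSpace ℝ d) → ℝ), Continuous φ →
                HasCompactSupport φ →
                ∀ K ⊆ offDiag (X := UnitAddTorus d) s, IsCompact K → ∀ δ > (0 : ℝ),
                  ∀ᶠ k in atTop, ∀ t ∈ Icc 0 T_B, ∀ xs ∈ K,
                    |velocityAverage φ (A k s n t) xs -
                      velocityAverage φ (boltzmannDuhamelTerm (Torus.geometry d) n s t
                        (fun j => tensorPow j (uncurry f₀))) xs| ≤ δ))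
    [Nonempty d] (hd : 2 ≤ Fintype.card d) {β₀ C₀ : ℝ} (hβ₀ : 0 < β₀) (hC₀ : 0 < C₀) :
    ∃ T > (0 : ℝ), ∀ f₀ : UnitAddTorus d → EuclideanSpace ℝ d → ℝ, IsLanfordDatum β₀ C₀ f₀ →
      ∫ x, ∫ v, f₀ x v = 1 →
      ∃ f : ℝ → UnitAddTorus d → EuclideanSpace ℝ d → ℝ,
        ContinuousInLanfordOn (Icc 0 T) (β₀ / 2) f ∧
        IsMildBoltzmannSolutionOn T (Torus.geometry d) hardSphereKernel f ∧ f 0 = f₀ ∧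
        ∀ (Nk : ℕ → ℕ) (ε : ℕ → ℝ), IsBoltzmannGradSequenceExact d 1 Nk ε → (∀ k, ε k < 2⁻¹) →
          ∀ Φ : (k : ℕ) → HardSphereFlow (Torus.geometry d) (ε k) (Nk k),
            ∃ F : ℕ → (s : ℕ) → ℝ → Config s d (UnitAddTorus d) → ℝ,
              (∀ k s, ∀ t ∈ Icc 0 T, F k s t =ᵐ[volume] nthMarginal (Nk k) s
                ((Φ k).good.indicator (hsTransport (Φ k) t
                  (canonicalDensity (Torus.geometry d) (ε k) (Nk k) (uncurry f₀))))) ∧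
              PropagatesChaos F (fun t z => f t z.1 z.2) T := by
  haveI := isFiniteMeasure_sphereMeasure (E := EuclideanSpace ℝ d)
  -- the three times
  obtain ⟨T₀, hT₀, hU⟩ := exists_ukaiLanford_uniform (d := d) hβ₀ hC₀
  obtain ⟨T_B, hT_B, hB⟩ := h hd hβ₀ hC₀
  set N : ℝ := max (2 * C₀) 1 with hN
  have hN1 : 1 ≤ N := le_max_right _ _
  set Cst : ℝ := exp 2 * sqrt 2 ^ (Fintype.card d + 3) *
    ((∫ u : EuclideanSpace ℝ d, (1 + ‖u‖) * exp (-(1 / 2) * ‖u‖ ^ 2)) *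
      (sphereMeasure : Measure (sphere (0 : EuclideanSpace ℝ d) 1)).real univ) + 1 with hCst
  have hJ : 0 ≤ ∫ u : EuclideanSpace ℝ d, (1 + ‖u‖) * exp (-(1 / 2) * ‖u‖ ^ 2) :=
    integral_nonneg fun u => by positivity
  have hCst0 : 0 < Cst := by
    have : 0 ≤ (∫ u : EuclideanSpace ℝ d, (1 + ‖u‖) * exp (-(1 / 2) * ‖u‖ ^ 2)) *
        (sphereMeasure : Measure (sphere (0 : EuclideanSpace ℝ d) 1)).real univ :=
      mul_nonneg hJ measureReal_nonneg
    positivity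
  have hsβ : 0 < sqrt (β₀ / 2) ^ (Fintype.card d + 1) := pow_pos (sqrt_pos.2 (half_pos hβ₀)) _
  set T_S : ℝ := sqrt (β₀ / 2) ^ (Fintype.card d + 1) / (2 * Cst * N) with hT_S
  have hT_S0 : 0 < T_S := by positivity
  set T : ℝ := min T₀ (min T_S T_B) with hT
  have hT0 : 0 < T := lt_min hT₀ (lt_min hT_S0 hT_B)
  have hTT₀ : T ≤ T₀ := min_le_left _ _
  have hTT_S : T ≤ T_S := (min_le_right _ _).trans (min_le_left _ _)
  have hTT_B : T ≤ T_B := (min_le_right _ _).trans (min_le_right _ _)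
  refine ⟨T, hT0, fun f₀ hf₀ hf₀1 => ?_⟩
  -- the Ukai–Lanford solution on `[0, T]`
  obtain ⟨f, hfC, hfM, hf0, hfb⟩ := hU f₀ hf₀
  have hfC' : ContinuousInLanfordOn (Icc 0 T) (β₀ / 2) f := hfC.mono (Icc_subset_Icc_right hTT₀)
  have hfM' : IsMildBoltzmannSolutionOn T (Torus.geometry d) hardSphereKernel f := hfM.mono hTT₀
  have hfN : ∀ t ∈ Icc 0 T, ∀ x v, |f t x v| ≤ N * exp (-(β₀ / 2 / 2) * ‖v‖ ^ 2) :=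
    fun t ht x v => (hfb t (Icc_subset_Icc_right hTT₀ ht) x v).trans
      (mul_le_mul_of_nonneg_right (le_max_left _ _) (exp_pos _).le)
  refine ⟨f, hfC', hfM', hf0, fun Nk ε hNε hε' Φ => ?_⟩
  -- the BBGKY side
  obtain ⟨A, M, r, β, hr0, hr1, hβ, hAm, hAb, hAae, hconv⟩ := hB f₀ hf₀ hf₀1 Nk ε hNε hε' Φ
  -- the Boltzmann side: Duhamel series of the tensor powers on `[0, T]`
  have hsmall : ∀ t ∈ Icc 0 T, 2 * Cst * N * t ≤ sqrt (β₀ / 2) ^ (Fintype.card d + 1) := by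
    intro t ht
    have h1 : t ≤ sqrt (β₀ / 2) ^ (Fintype.card d + 1) / (2 * Cst * N) := ht.2.trans hTT_S
    have h2 : 0 < 2 * Cst * N := by positivity
    calc 2 * Cst * N * t
        ≤ 2 * Cst * N * (sqrt (β₀ / 2) ^ (Fintype.card d + 1) / (2 * Cst * N)) := by
          gcongr
      _ = sqrt (β₀ / 2) ^ (Fintype.card d + 1) := by field_simp
  have hBoltz := fun t (ht : t ∈ Icc 0 T) (s : ℕ) (Z : Config s d (UnitAddTorus d)) =>
    hfM'.hasSum_boltzmannDuhamelTerm_tensorPow_of_le (half_pos hβ₀) hN1 hfC' hfN ht (hsmall t ht)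
      s Z
  -- data of the Boltzmann side are nice (measurability of the Boltzmann Duhamel terms)
  have hf₀c : Continuous (Function.uncurry f₀) := hf₀.2.1.1
  have hf₀b : ∀ x v, |f₀ x v| ≤ C₀ * exp (-(β₀ / 2) * ‖v‖ ^ 2) :=
    abs_le_of_eGaussSupNorm_le hC₀.le hf₀.2.2
  have hGm : Measurable fun p : UnitAddTorus d × EuclideanSpace ℝ d =>
      (Torus.geometry d).translate p.1 p.2 :=
    Torus.continuous_translate_uncurry.measurable
  have hnice : ∀ j, IsNice (tensorPow j (uncurry f₀) : Config j d (UnitAddTorus d) → ℝ) := fun j =>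
    ⟨measurable_tensorPow hf₀c.measurable j,
      ⟨C₀ ^ j, β₀, hβ₀, fun Z => abs_tensorPow_le_pow_mul_exp (fun z => hf₀b z.1 z.2) Z⟩⟩
  have hBterm_meas : ∀ s n, ∀ t ∈ Icc 0 T,
      Measurable
        (boltzmannDuhamelTerm (Torus.geometry d) n s t (fun j => tensorPow j (uncurry f₀))) := by
    intro s n t ht
    have hm := (isNice_duhamelTerm (boltzmannModel (Torus.geometry d) hGm 1) hnice n s ht.1).1
    have heq : duhamelTerm (boltzmannModel (Torus.geometry d) hGm 1).transport
        (boltzmannModel (Torus.geometry d) hGm 1).op n s t (fun j => tensorPow j (uncurry f₀)) =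
        boltzmannDuhamelTerm (Torus.geometry d) n s t (fun j => tensorPow j (uncurry f₀)) := by
      funext Z
      rw [duhamelTerm_boltzmannModel, one_pow, one_mul]
    rwa [heq] at hm
  -- merged majorants
  set M' : ℕ → ℝ := fun s => max (max (M s) 0) ((1 + exp (s - 1 : ℝ)) * N ^ s) with hM'
  set r' : ℝ := max r 2⁻¹ with hr'
  set β' : ℝ := min β (β₀ / 2 / 2) with hβ'
  have hr'0 : 0 ≤ r' := hr0.trans (le_max_left _ _)
  have hr'1 : r' < 1 := max_lt hr1 (by norm_num)
  have hβ'0 : 0 < β' := lt_min hβ (by positivity)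
  have hE0 : ∀ {s : ℕ} (Z : Config s d (UnitAddTorus d)), 0 ≤ configEnergy Z := fun Z => by
    unfold configEnergy; positivity
  have hmono : ∀ {s : ℕ} (n : ℕ) (Z : Config s d (UnitAddTorus d)) {m ρ γ : ℝ}, 0 ≤ m → m ≤ M' s →
      0 ≤ ρ → ρ ≤ r' → β' ≤ γ →
      m * ρ ^ n * exp (-γ * configEnergy Z) ≤ M' s * r' ^ n * exp (-β' * configEnergy Z) := by
    intro s n Z m ρ γ hm hmM hρ hρr hγ
    have h1 : ρ ^ n ≤ r' ^ n := pow_le_pow_left₀ hρ hρr n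
    have h2 : exp (-γ * configEnergy Z) ≤ exp (-β' * configEnergy Z) :=
      exp_le_exp.2 (by nlinarith [hE0 Z])
    have hM'0 : 0 ≤ M' s := hm.trans hmM
    calc m * ρ ^ n * exp (-γ * configEnergy Z) ≤ M' s * r' ^ n * exp (-γ * configEnergy Z) := by
          gcongr
      _ ≤ M' s * r' ^ n * exp (-β' * configEnergy Z) := by gcongr
  -- the versions: sums of the BBGKY Duhamel series
  have hAsum : ∀ k s, ∀ t ∈ Icc 0 T, ∀ Z, HasSum (fun n => A k s n t Z) (∑' n, A k s n t Z) := by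
    intro k s t ht Z
    have htB : t ∈ Icc 0 T_B := Icc_subset_Icc_right hTT_B ht
    refine (Summable.of_norm_bounded (g := fun n => max (M s) 0 * r ^ n * exp (-β * configEnergy Z))
      (((summable_geometric_of_lt_one hr0 hr1).mul_left _).mul_right _) fun n => ?_).hasSum
    rw [Real.norm_eq_abs]
    exact (hAb k s n t htB Z).trans (by gcongr; exact le_max_left _ _)
  refine ⟨fun k s t Z => ∑' n, A k s n t Z,
    fun k s t ht => hAae k s t (Icc_subset_Icc_right hTT_B ht), ?_⟩
  -- mode-A convergence by dominated convergence of the two series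
  refine propagatesChaos_of_hasSum (f := fun t z => f t z.1 z.2)
    (fun s k n t => A k s n t)
    (fun s n t => boltzmannDuhamelTerm (Torus.geometry d) n s t (fun j => tensorPow j (uncurry f₀)))
    M' hβ'0 hr'0 hr'1 ?_ ?_ ?_ ?_ ?_ ?_ ?_
  · exact fun s k n t ht => hAm k s n t (Icc_subset_Icc_right hTT_B ht)
  · exact fun s n t ht => hBterm_meas s n t ht
  · intro s k n t ht Z
    refine (hAb k s n t (Icc_subset_Icc_right hTT_B ht) Z).trans ?_
    refine (mul_le_mul_of_nonneg_right (mul_le_mul_of_nonneg_right (le_max_left (M s) 0)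
      (pow_nonneg hr0 n)) (exp_pos _).le).trans ?_
    exact hmono n Z (le_max_right _ _) (le_max_left _ _) hr0 (le_max_left _ _) (min_le_left _ _)
  · intro s n t ht Z
    rw [← hf0]
    refine ((hBoltz t ht s Z).1 n).trans ?_
    have h1 : 0 ≤ (1 + exp (s - 1 : ℝ)) * N ^ s := by positivity
    exact hmono n Z h1 (le_max_right _ _) (by norm_num) (le_max_right _ _) (min_le_right _ _)
  · exact fun s k t ht Z => hAsum k s t ht Z
  · intro s t ht Z
    have h2 := (hBoltz t ht s Z).2
    rw [hf0] at h2
    exact h2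
  · intro s n φ hφ hφc K hK hKc δ hδ
    filter_upwards [hconv s n φ hφ hφc K hK hKc δ hδ] with k hk t ht xs hxs
    exact hk t (Icc_subset_Icc_right hTT_B ht) xs hxs


/-- **`lanford_tendstoEmpirical` from the canonical BBGKY-side term-by-term analysis**
(hilbert6.S08 reduced to the canonical twin of the remaining input of hilbert6.S02): the
hypothesis of `canonicalChaos_of_bbgkySide` implies Lanford's theorem in mode B for the canonical
ensemble, through `lanford_tendstoEmpirical_of_canonicalChaos` (eventual positivity of `𝒵_{N_k}`,
conservation of mass, `N_k → ∞`, and mode A for versions ⇒ mode B, `Sweep1EmpiricalProofs`).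
[cite: CIP1994, §4.4 Thm 4.4.1, proof, Steps 1–4, pp. 77–86, and §4.6] -/
theorem lanford_tendstoEmpirical_of_bbgkySide
    (h : ∀ (_hd : 2 ≤ Fintype.card d) {β₀ C₀ : ℝ}, 0 < β₀ → 0 < C₀ →
      ∃ T_B > (0 : ℝ), ∀ f₀ : UnitAddTorus d → EuclideanSpace ℝ d → ℝ, IsLanfordDatum β₀ C₀ f₀ →
        ∫ x, ∫ v, f₀ x v = 1 →
        ∀ (Nk : ℕ → ℕ) (ε : ℕ → ℝ), IsBoltzmannGradSequenceExact d 1 Nk ε → (∀ k, ε k < 2⁻¹) →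
          ∀ Φ : (k : ℕ) → HardSphereFlow (Torus.geometry d) (ε k) (Nk k),
            ∃ (A : ℕ → (s : ℕ) → ℕ → ℝ → Config s d (UnitAddTorus d) → ℝ) (M : ℕ → ℝ) (r β : ℝ),
              0 ≤ r ∧ r < 1 ∧ 0 < β ∧
              (∀ k s n, ∀ t ∈ Icc 0 T_B, Measurable (A k s n t)) ∧
              (∀ k s n, ∀ t ∈ Icc 0 T_B, ∀ Z,
                |A k s n t Z| ≤ M s * r ^ n * exp (-β * configEnergy Z)) ∧
              (∀ k s, ∀ t ∈ Icc 0 T_B,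
                (fun Z => ∑' n, A k s n t Z) =ᵐ[volume]
                  nthMarginal (Nk k) s ((Φ k).good.indicator (hsTransport (Φ k) t
                    (canonicalDensity (Torus.geometry d) (ε k) (Nk k) (uncurry f₀))))) ∧
              (∀ (s n : ℕ) (φ : (Fin s → EuclideanSpace ℝ d) → ℝ), Continuous φ →
                HasCompactSupport φ →
                ∀ K ⊆ offDiag (X := UnitAddTorus d) s, IsCompact K → ∀ δ > (0 : ℝ),
                  ∀ᶠ k in atTop, ∀ t ∈ Icc 0 T_B, ∀ xs ∈ K,
                    |velocityAverage φ (A k s n t) xs -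
                      velocityAverage φ (boltzmannDuhamelTerm (Torus.geometry d) n s t
                        (fun j => tensorPow j (uncurry f₀))) xs| ≤ δ)) :
    lanford_tendstoEmpirical (d := d) :=
  lanford_tendstoEmpirical_of_canonicalChaos (by
    intro _ hd β₀ C₀ hβ₀ hC₀
    exact canonicalChaos_of_bbgkySide h hd hβ₀ hC₀)

end Assembly

end

end Literature.MathematicalPhysics.KineticTheory
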